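import Summits.Ventures.CertifiedManyBodySolver.Rows.RectMarginalNodesAnderson
import HarnessLib

/-!
# Square-lattice window-marginal nodes — part 3/4: §5  Window-LTI matrices: the term dictionary and the DOMINANCE edge "Anderson sub-cluster ⇒ LTI node"

HONEST FRAMING: first certified bounds; not a superconductivity verdict; every number certified or labelled float.
This module proves SOUNDNESS / DOMINANCE statements (inequalities between relaxations); it certifies no new number.

Continuation of `Rows/RectMarginalNodes.lean` (full module docstring, conventions, named gaps G-SYM-2D / G-ISO there). THIS module: §5 the window-LTI matrix dictionary (`wfun`, `WindowLTI.wfun_*`, `wBond` / `wSite` / `wDens`) and the DOMINANCE edge `ltiRectNode_of_andersonCluster_subset` (+ `_andersonRect_subset`, `_andersonCluster_transposePair_subset`, instance `ltiRectNode_of_rect2x4rot_opt_U8`).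

FILING NOTE (sr-mbsolver-lit-4 g9, 2026-08-22): the four modules `Rows/RectMarginalNodes.lean` → `…Anderson.lean` → `…Dominance.lean` → `…GS.lean`
are sr-mbsolver-op-07 gen-11's PROVED HOME file `HOME/sr-mbsolver-op-07/lean/RectMarginalNodes.lean` (sha256 b7b18754ae1e5299…, 1 018 lines, 71 theorems +
15 defs, sorry-free; FILE REQUEST HOME INBOX l.4956, one-writer rule) split at its §3 / §5 / §6 headings to respect the gate's 400-line module
limit, with the working namespace `…CertifiedManyBodySolver.Sketch2D` renamed `Summit.Ventures.CertifiedManyBodySolver.Rows.RectMarginalNodes`; declarations,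
statements and proofs are otherwise VERBATIM except two gate-driven edits: op-07's `sum_polySite_eq` is replaced by the landed
`Rows.AndersonDominatedByLTI.sum_ofLex_eq'` (dedup) and 22 one-line docstrings were added (lint.docstring). Contents by module: (1) §0 bookkeeping, §1 the TI dictionary (`bondEnergy` / `siteEnergy` / `densityC`, `expect_clusterHamiltonian`, `hubbardEnergyDensity_eq_re`), §2 `TIStateNode` + transport `TIStateNode.le_energyDensity2D`, tightness, cells `.m2EnergyLowerRow` / `.m3EnergyLowerRow`; (2) §3 the PROVED edge Anderson cluster floor ⇒ `TIStateNode` (`tiStateNode_of_andersonCluster_transposePair`, `tiStateNode_of_andersonRect`, instance `tiStateNode_of_rect2x4rot_opt_U8`) and §4 the matrix-level node `LTIRectNode` (`WindowLTI`, `hAvg`) with its PROVED soundness `LTIRectNode.tiStateNode` / `.m3EnergyLowerRow` / `.m2EnergyLowerRow`;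
(3) §5 the window-LTI matrix dictionary (`wfun`, `WindowLTI.wfun_*`, `wBond` / `wSite` / `wDens`) and the DOMINANCE edge `ltiRectNode_of_andersonCluster_subset` (+ `_andersonRect_subset`, `_andersonCluster_transposePair_subset`, instance `ltiRectNode_of_rect2x4rot_opt_U8`); (4) §6 the ground-state-class node `LTIRectGSNode` (LTI + `S^z` + local-stability rows, `stabilityObs`) with its PROVED soundness `LTIRectGSNode.le_energyDensity2D` / cells and `LTIRectNode.gsNode`.
-/

noncomputable section

open Matrix Complex Finset
open scoped ComplexOrder MatrixOrder BigOperators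
open Literature.Probability.LatticeModels
open Literature.MathematicalPhysics.QuantumLattice
open Literature.MathematicalPhysics.QuantumLattice.AndersonCluster
open Literature.MathematicalPhysics.QuantumLattice.HubbardWave0
open Literature.MathematicalPhysics.QuantumLattice.ThermodynamicLimit

namespace Summit.Ventures.CertifiedManyBodySolver.Rows.RectMarginalNodes

/-! ## §5  Window-LTI matrices: the term dictionary and the DOMINANCE edge "Anderson sub-cluster ⇒ LTI node" -/

section Dominance

variable {W : Finset (Site 2)}

/-- The local functional of a window matrix `ρ` on a sub-region `S ⊆ W`: `A ↦ Tr ρ Γ(S ↪ W) A`. -/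
def wfun (ρ : FermionOp W) {S : Finset (Site 2)} (hS : S ⊆ W) : FermionOp S →ₗ[ℂ] ℂ where
  toFun A := (ρ * fermionEmbed (PolySite.incl hS) A).trace
  map_add' A B := by rw [map_add, Matrix.mul_add, Matrix.trace_add]
  map_smul' c A := by rw [map_smul, Matrix.mul_smul, Matrix.trace_smul, RingHom.id_apply]

/-- Unfolding `wfun`: `wfun ρ hS A = Tr (ρ · Γ(S ↪ W) A)` (definitional). -/
theorem wfun_apply (ρ : FermionOp W) {S : Finset (Site 2)} (hS : S ⊆ W) (A : FermionOp S) :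
    wfun ρ hS A = (ρ * fermionEmbed (PolySite.incl hS) A).trace := rfl

/-- `Tr ρ A = wfun ρ (W ⊆ W) A`. -/
theorem trace_mul_eq_wfun (ρ A : FermionOp W) : (ρ * A).trace = wfun ρ (subset_refl W) A := by
  rw [wfun_apply, PolySite.incl_rfl, fermionEmbed_refl_apply]

/-- Compatibility along `S ⊆ S' ⊆ W`. -/
theorem wfun_fermionEmbed_incl (ρ : FermionOp W) {S S' : Finset (Site 2)} (hSS' : S ⊆ S') (hS' : S' ⊆ W)
    (A : FermionOp S) : wfun ρ hS' (fermionEmbed (PolySite.incl hSS') A) = wfun ρ (hSS'.trans hS') A := by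
  rw [wfun_apply, wfun_apply, fermionEmbed_fermionEmbed, PolySite.incl_trans]

/-- Translation followed by inclusion on generators: `Γ(S → S+v ↪ W) c_{yσ} = c_{y+v,σ}`. -/
theorem fermionEmbed_shiftEmb_trans_incl_cAt {S : Finset (Site 2)} (v : Site 2) (hSv : shiftSet v S ⊆ W) (y : Site 2)
    (hy : y ∈ S) (σ : Fin 2) :
    fermionEmbed ((PolySite.shiftEmb v S).trans (PolySite.incl hSv)) (cAt y hy σ) =
      cAt (y + v) (hSv (PolySite.add_mem_shiftSet v hy)) σ := by
  rw [cAt, fermionEmbed_annihilation]; rfl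

/-- The number operator is `c† c` (definitional). -/
theorem nAt_eq_cAt {Λ : Finset (Site 2)} (x : Site 2) (hx : x ∈ Λ) (σ : Fin 2) :
    nAt x hx σ = (cAt x hx σ)ᴴ * cAt x hx σ := rfl

variable {ρ : FermionOp W} (hρ : WindowLTI ρ) (t U : ℝ)
include hρ

/-- **LTI ⇒ the bond term does not depend on the bond** (matrix level): `Tr ρ Φ{x,x+e_i} = Tr ρ Φ{0,e_i}`. -/
theorem WindowLTI.wfun_pair (x : Site 2) (i : Fin 2) (hx : ({x, x + unitVec i} : Finset (Site 2)) ⊆ W)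
    (h0 : ({0, 0 + unitVec i} : Finset (Site 2)) ⊆ W) :
    wfun ρ hx ((hubbardFermionInteraction 2 t U).Φ {x, x + unitVec i}) =
      wfun ρ h0 ((hubbardFermionInteraction 2 t U).Φ {0, 0 + unitVec i}) := by
  have hSv : shiftSet x ({0, 0 + unitVec i} : Finset (Site 2)) ⊆ W :=
    (InfVolFermionState.shiftSet_pair_zero_subset x i).trans hx
  rw [wfun_apply, wfun_apply, hρ {0, 0 + unitVec i} x h0 hSv]
  congr 2
  have e0 : ∀ (h : 0 + x ∈ W) (h' : x ∈ W) (σ : Fin 2), cAt (0 + x) h σ = cAt x h' σ :=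
    fun h h' σ => cAt_congr h h' (zero_add x) σ
  have e1 : ∀ (h : 0 + unitVec i + x ∈ W) (h' : x + unitVec i ∈ W) (σ : Fin 2),
      cAt (0 + unitVec i + x) h σ = cAt (x + unitVec i) h' σ :=
    fun h h' σ => cAt_congr h h' (by rw [zero_add, add_comm]) σ
  simp only [hubbardFermionInteraction_apply_pair, map_smul, map_sum, map_add, map_mul, fermionEmbed_conjTranspose,
    fermionEmbed_incl_cAt, fermionEmbed_shiftEmb_trans_incl_cAt, e0 _ (hx (mem_insert_self _ _)),
    e1 _ (hx (mem_insert_of_mem (mem_singleton_self _)))]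

/-- **LTI ⇒ the on-site term does not depend on the site** (matrix level). -/
theorem WindowLTI.wfun_singleton (x : Site 2) (hx : ({x} : Finset (Site 2)) ⊆ W) (h0 : ({0} : Finset (Site 2)) ⊆ W) :
    wfun ρ hx ((hubbardFermionInteraction 2 t U).Φ {x}) = wfun ρ h0 ((hubbardFermionInteraction 2 t U).Φ {0}) := by
  have hSv : shiftSet x ({0} : Finset (Site 2)) ⊆ W := (InfVolFermionState.shiftSet_singleton_zero_subset x).trans hx
  rw [wfun_apply, wfun_apply, hρ {0} x h0 hSv]
  congr 2
  have e0 : ∀ (h : 0 + x ∈ W) (h' : x ∈ W) (σ : Fin 2), cAt (0 + x) h σ = cAt x h' σ :=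
    fun h h' σ => cAt_congr h h' (zero_add x) σ
  simp only [hubbardFermionInteraction_apply_singleton, nAt_eq_cAt, map_smul, map_mul, fermionEmbed_conjTranspose,
    fermionEmbed_incl_cAt, fermionEmbed_shiftEmb_trans_incl_cAt, e0 _ (hx (mem_singleton_self _))]

/-- **LTI ⇒ the local density does not depend on the site** (matrix level). -/
theorem WindowLTI.wfun_nAt_add (x : Site 2) (hx : ({x} : Finset (Site 2)) ⊆ W) (h0 : ({0} : Finset (Site 2)) ⊆ W) :
    wfun ρ hx (nAt x (mem_singleton_self x) 0 + nAt x (mem_singleton_self x) 1) =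
      wfun ρ h0 (nAt 0 (mem_singleton_self 0) 0 + nAt 0 (mem_singleton_self 0) 1) := by
  have hSv : shiftSet x ({0} : Finset (Site 2)) ⊆ W := (InfVolFermionState.shiftSet_singleton_zero_subset x).trans hx
  rw [wfun_apply, wfun_apply, hρ {0} x h0 hSv]
  congr 2
  have e0 : ∀ (h : 0 + x ∈ W) (h' : x ∈ W) (σ : Fin 2), cAt (0 + x) h σ = cAt x h' σ :=
    fun h h' σ => cAt_congr h h' (zero_add x) σ
  simp only [nAt_eq_cAt, map_add, map_mul, fermionEmbed_conjTranspose, fermionEmbed_incl_cAt,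
    fermionEmbed_shiftEmb_trans_incl_cAt, e0 _ (hx (mem_singleton_self _))]

omit hρ in
/-- If both nearest-neighbour pairs `{0, e_i}` lie in the window then so does `{0}`. -/
theorem zero_singleton_subset_of_pair (hW : ∀ i : Fin 2, ({0, 0 + unitVec i} : Finset (Site 2)) ⊆ W) :
    ({0} : Finset (Site 2)) ⊆ W :=
  singleton_subset_iff.2 (hW 0 (mem_insert_self _ _))

/-- The reference bond value `Tr ρ Φ{0, e_i}` of a window matrix. -/
def wBond (ρ : FermionOp W) (t U : ℝ) (hW : ∀ i : Fin 2, ({0, 0 + unitVec i} : Finset (Site 2)) ⊆ W) (i : Fin 2) : ℂ :=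
  wfun ρ (hW i) ((hubbardFermionInteraction 2 t U).Φ {0, 0 + unitVec i})

/-- The reference on-site value `Tr ρ Φ{0}`. -/
def wSite (ρ : FermionOp W) (t U : ℝ) (hW : ∀ i : Fin 2, ({0, 0 + unitVec i} : Finset (Site 2)) ⊆ W) : ℂ :=
  wfun ρ (zero_singleton_subset_of_pair hW) ((hubbardFermionInteraction 2 t U).Φ {0})

/-- The reference density `Tr ρ (n_{0↑} + n_{0↓})`. -/
def wDens (ρ : FermionOp W) (hW : ∀ i : Fin 2, ({0, 0 + unitVec i} : Finset (Site 2)) ⊆ W) : ℂ :=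
  wfun ρ (zero_singleton_subset_of_pair hW) (nAt 0 (mem_singleton_self 0) 0 + nAt 0 (mem_singleton_self 0) 1)

variable (hW : ∀ i : Fin 2, ({0, 0 + unitVec i} : Finset (Site 2)) ⊆ W) {R : Finset (Site 2)} (hR : R ⊆ W)

/-- Matrix-level twin of `neg_t_mul_expect_clusterBondKinetic` for an embedded sub-cluster `R ⊆ W`. -/
theorem WindowLTI.neg_t_mul_wfun_clusterBondKinetic (y : PolySite R) (i : Fin 2) :
    -(t : ℂ) * wfun ρ hR (clusterBondKinetic R y i) =
      if ofLex y.1 + unitVec i ∈ R then wBond ρ t U hW i else 0 := by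
  by_cases h : ofLex y.1 + unitVec i ∈ R
  · rw [if_pos h]
    have h2 : ({ofLex y.1, ofLex y.1 + unitVec i} : Finset (Site 2)) ⊆ R :=
      insert_subset (PolySite.ofLex_mem y) (singleton_subset_iff.2 h)
    have key : fermionEmbed (PolySite.incl h2)
        ((hubbardFermionInteraction 2 t U).Φ {ofLex y.1, ofLex y.1 + unitVec i}) =
        -(t : ℂ) • clusterBondKinetic R y i := by
      rw [hubbardFermionInteraction_apply_pair, clusterBondKinetic, dif_pos h]
      simp only [map_smul, map_sum, map_add, map_mul, fermionEmbed_conjTranspose, fermionEmbed_incl_cAt]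
      rfl
    rw [wBond, ← hρ.wfun_pair t U (ofLex y.1) i (h2.trans hR) (hW i), ← wfun_fermionEmbed_incl ρ h2 hR, key,
      map_smul, smul_eq_mul]
  · rw [if_neg h, clusterBondKinetic, dif_neg h, map_zero, mul_zero]

/-- Matrix-level twin of `U_mul_expect_numberOp_mul`. -/
theorem WindowLTI.U_mul_wfun_numberOp_mul (y : PolySite R) :
    (U : ℂ) * wfun ρ hR (numberOp y 0 * numberOp y 1) = wSite ρ t U hW := by
  have h1 : ({ofLex y.1} : Finset (Site 2)) ⊆ R := singleton_subset_iff.2 (PolySite.ofLex_mem y)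
  have key : fermionEmbed (PolySite.incl h1) ((hubbardFermionInteraction 2 t U).Φ {ofLex y.1}) =
      (U : ℂ) • (numberOp y 0 * numberOp y 1) := by
    rw [hubbardFermionInteraction_apply_singleton]
    simp only [map_smul, map_mul, nAt, fermionEmbed_numberOp, PolySite.incl_pt]
    rfl
  rw [wSite, ← hρ.wfun_singleton t U (ofLex y.1) (h1.trans hR), ← wfun_fermionEmbed_incl ρ h1 hR, key, map_smul,
    smul_eq_mul]

/-- Matrix-level twin of `expect_numberOp_add`. -/
theorem WindowLTI.wfun_numberOp_add (y : PolySite R) :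
    wfun ρ hR (numberOp y 0 + numberOp y 1) = wDens ρ hW := by
  have h1 : ({ofLex y.1} : Finset (Site 2)) ⊆ R := singleton_subset_iff.2 (PolySite.ofLex_mem y)
  have key : fermionEmbed (PolySite.incl h1)
      (nAt (ofLex y.1) (mem_singleton_self _) 0 + nAt (ofLex y.1) (mem_singleton_self _) 1) =
      numberOp y 0 + numberOp y 1 := by
    simp only [map_add, nAt, fermionEmbed_numberOp, PolySite.incl_pt]
    rfl
  rw [wDens, ← hρ.wfun_nAt_add (ofLex y.1) (h1.trans hR), ← wfun_fermionEmbed_incl ρ h1 hR, key]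

/-- **The value of an embedded weighted cluster Hamiltonian on a window-LTI matrix** is read off the weight sums
(matrix-level twin of `expect_clusterHamiltonian`). -/
theorem WindowLTI.wfun_clusterHamiltonian (J : Site 2 → Fin 2 → ℝ) (V μ : Site 2 → ℝ) :
    wfun ρ hR (clusterHamiltonian R t U J V μ) =
      ∑ i : Fin 2, ((bondWeightSum R J i : ℝ) : ℂ) * wBond ρ t U hW i +
        ((siteWeightSum R V : ℝ) : ℂ) * wSite ρ t U hW + ((siteWeightSum R μ : ℝ) : ℂ) * wDens ρ hW := by
  have hA' : ∀ (y : PolySite R) (i : Fin 2),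
      -(t : ℂ) * (((J (ofLex y.1) i : ℝ) : ℂ) * wfun ρ hR (clusterBondKinetic R y i)) =
        ((bondWeight R J (ofLex y.1) i : ℝ) : ℂ) * wBond ρ t U hW i := by
    intro y i
    rw [mul_left_comm, hρ.neg_t_mul_wfun_clusterBondKinetic t U hW hR y i]
    unfold AndersonCluster.bondWeight
    split_ifs <;> simp
  have hA : wfun ρ hR (-(t : ℂ) • ∑ y : PolySite R, ∑ i : Fin 2,
      ((J (ofLex y.1) i : ℝ) : ℂ) • clusterBondKinetic R y i) =
      ∑ i : Fin 2, ((bondWeightSum R J i : ℝ) : ℂ) * wBond ρ t U hW i := by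
    simp only [map_smul, map_sum, smul_eq_mul, Finset.mul_sum, hA']
    rw [Finset.sum_comm]
    refine Finset.sum_congr rfl fun i _ => ?_
    rw [← Finset.sum_mul, AndersonCluster.bondWeightSum, ← AndersonDominatedByLTI.sum_ofLex_eq' R (fun x => bondWeight R J x i),
      Complex.ofReal_sum]
  have hB : wfun ρ hR ((U : ℂ) • ∑ y : PolySite R,
      ((V (ofLex y.1) : ℝ) : ℂ) • (numberOp y 0 * numberOp y 1)) =
      ((siteWeightSum R V : ℝ) : ℂ) * wSite ρ t U hW := by
    simp only [map_smul, map_sum, smul_eq_mul, Finset.mul_sum]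
    have : ∀ y : PolySite R, (U : ℂ) * (((V (ofLex y.1) : ℝ) : ℂ) * wfun ρ hR (numberOp y 0 * numberOp y 1)) =
        ((V (ofLex y.1) : ℝ) : ℂ) * wSite ρ t U hW := fun y => by
      rw [mul_left_comm, hρ.U_mul_wfun_numberOp_mul t U hW hR y]
    simp only [this]
    rw [← Finset.sum_mul, AndersonCluster.siteWeightSum, ← AndersonDominatedByLTI.sum_ofLex_eq' R V, Complex.ofReal_sum]
  have hC : wfun ρ hR (∑ y : PolySite R, ((μ (ofLex y.1) : ℝ) : ℂ) • (numberOp y 0 + numberOp y 1)) =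
      ((siteWeightSum R μ : ℝ) : ℂ) * wDens ρ hW := by
    simp only [map_sum, map_smul, smul_eq_mul, hρ.wfun_numberOp_add hW hR]
    rw [← Finset.sum_mul, AndersonCluster.siteWeightSum, ← AndersonDominatedByLTI.sum_ofLex_eq' R μ, Complex.ofReal_sum]
  rw [clusterHamiltonian, map_add, map_add, hA, hB, hC]

/-- The value of an embedded weighted Anderson cluster on a window-LTI matrix. -/
theorem WindowLTI.wfun_andersonCluster (w : Site 2 → Fin 2 → ℝ) (v : Site 2 → ℝ) :
    wfun ρ hR (andersonCluster R t U w v) =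
      ∑ i : Fin 2, ((bondWeightSum R w i : ℝ) : ℂ) * wBond ρ t U hW i +
        ((siteWeightSum R v : ℝ) : ℂ) * wSite ρ t U hW +
        ((-(U / 2) * siteWeightSum R v : ℝ) : ℂ) * wDens ρ hW +
        ((U / 2 * siteWeightSum R v : ℝ) : ℂ) * wfun ρ hR 1 := by
  rw [andersonCluster_eq, map_add, map_smul, hρ.wfun_clusterHamiltonian t U hW hR, smul_eq_mul,
    siteWeightSum_const_mul]

/-- The mean particle number of a window-LTI matrix is `|W|` times the reference density. -/
theorem WindowLTI.trace_mul_totalNumber : (ρ * totalNumber).trace = (W.card : ℂ) * wDens ρ hW := by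
  rw [trace_mul_eq_wfun, totalNumber]
  simp only [Fin.sum_univ_two, map_sum, hρ.wfun_numberOp_add hW (subset_refl W), Finset.sum_const,
    Finset.card_univ, nsmul_eq_mul, card_polySite]

omit hρ in
/-- The reference bonds `{0, e_i}` lie in every rectangle with `a, b ≥ 2`. -/
theorem pair_subset_rectWindow {a b : ℕ} (ha : 2 ≤ a) (hb : 2 ≤ b) (i : Fin 2) :
    ({0, 0 + unitVec i} : Finset (Site 2)) ⊆ rectWindow a b := by
  intro y hy
  rw [mem_rectWindow']
  rcases Finset.mem_insert.1 hy with rfl | hy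
  · simp only [Pi.zero_apply, le_refl, true_and]
    constructor <;> omega
  · rw [Finset.mem_singleton] at hy
    subst hy
    fin_cases i <;> simp [unitVec] <;> omega

omit hρ in
/-- **DOMINANCE EDGE (matrix level): an Anderson floor of ANY weighted sub-cluster of the window with unit bond
weight per direction is a valid inequality of the LTI rectangle node.**  If `R ⊆ [0,a) × [0,b)` (`a, b ≥ 2`),
`Σ_{∥e_0} w = Σ_{∥e_1} w = 1`, `Σ v = 1` and `h(R; w, v) ⪰ q`, then every feasible point `ρ` of
`LTIRectNode t U a b n ·` has `Re Tr ρ h_avg ≥ q - (U/2)(1 - n)`; i.e. the certified optimum of the LTI rectangle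
SDP is `≥` the Anderson bound of every such sub-cluster (the bare `a × b` Anderson tiling bound included:
`R = W`, uniform weights).  Proof: `0 ≤ Tr ρ (Γ(R ↪ W)(h(R) - q)) = Σ_i W_i Re hb_i + Re u - (U/2) Re n_0 + U/2 - q`
by the LTI dictionary, `Re n_0 = n` by the density row, and `Re Tr ρ h_avg = Re hb_0 + Re hb_1 + Re u`. -/
theorem ltiRectNode_of_andersonCluster_subset (t U n : ℝ) {a b : ℕ} (ha : 2 ≤ a) (hb : 2 ≤ b)
    (R : Finset (Site 2)) (hR : R ⊆ rectWindow a b) (w : Site 2 → Fin 2 → ℝ) (v : Site 2 → ℝ) {q : ℝ}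
    (hw0 : bondWeightSum R w 0 = 1) (hw1 : bondWeightSum R w 1 = 1) (hv : siteWeightSum R v = 1)
    (hq : (andersonCluster R t U w v - (q : ℂ) • (1 : FermionOp R)).PosSemidef) :
    LTIRectNode t U a b n (q - U / 2 * (1 - n)) := by
  intro ρ hpsd htr hlti hdens
  have hW := pair_subset_rectWindow ha hb
  have hpos := Literature.LinearAlgebra.Matrix.re_trace_mul_nonneg_of_posSemidef hpsd
    (posSemidef_fermionEmbed_sub_smul_one (PolySite.incl hR) hq)
  have h1 : wfun ρ hR 1 = 1 := by rw [wfun_apply, map_one, Matrix.mul_one, htr]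
  have hval : (ρ * (fermionEmbed (PolySite.incl hR) (andersonCluster R t U w v) -
      (q : ℂ) • (1 : FermionOp (rectWindow a b)))).trace = wfun ρ hR (andersonCluster R t U w v) - q := by
    rw [Matrix.mul_sub, Matrix.trace_sub, Matrix.mul_smul, Matrix.trace_smul, Matrix.mul_one, htr, smul_eq_mul, mul_one,
      wfun_apply]
  rw [hval, hlti.wfun_andersonCluster t U hW hR, hv, h1, Fin.sum_univ_two, hw0, hw1] at hpos
  rw [trace_mul_eq_wfun, hAvg, hlti.wfun_clusterHamiltonian t U hW (subset_refl _), Fin.sum_univ_two,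
    bondWeightSum_avgBond_zero ha (by omega), bondWeightSum_avgBond_one (by omega) hb,
    siteWeightSum_avgSite (by omega) (by omega), siteWeightSum_zero]
  rw [hlti.trace_mul_totalNumber hW] at hdens
  have hcard := card_rectWindow' a b
  have hab : (0 : ℝ) < (a : ℝ) * b := by positivity
  have hd : (wDens ρ hW).re = n := by
    simp only [Complex.mul_re, Complex.natCast_re, Complex.natCast_im, zero_mul, sub_zero, hcard] at hdens
    exact mul_left_cancel₀ hab.ne' hdens
  simp only [Complex.add_re, Complex.sub_re, Complex.mul_re, Complex.ofReal_re, Complex.ofReal_im, Complex.one_re,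
    zero_mul, sub_zero, one_mul, hd] at hpos ⊢
  linarith

omit hρ in
/-- The same in rectangle coordinates, for a sub-rectangle `[0,a') × [0,b') ⊆ [0,a) × [0,b)` carrying a weight
table (the form of the tree's `rect` certificate rows; e.g. the window itself, `a' = a`, `b' = b`). -/
theorem ltiRectNode_of_andersonRect_subset (t U n : ℝ) {a b a' b' : ℕ} (ha : 2 ≤ a) (hb : 2 ≤ b) (ha' : a' ≤ a)
    (hb' : b' ≤ b) (w : ℕ → ℕ → Fin 2 → ℝ) (v : ℕ → ℕ → ℝ) {q : ℝ}
    (hw0 : ∑ c ∈ Finset.range (a' - 1), ∑ r ∈ Finset.range b', w c r 0 = 1)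
    (hw1 : ∑ c ∈ Finset.range a', ∑ r ∈ Finset.range (b' - 1), w c r 1 = 1)
    (hv : ∑ c ∈ Finset.range a', ∑ r ∈ Finset.range b', v c r = 1)
    (hq : (andersonCluster (rectWindow a' b') t U (rectBondWeights w) (rectSiteWeights v) -
      (q : ℂ) • (1 : FermionOp (rectWindow a' b'))).PosSemidef) :
    LTIRectNode t U a b n (q - U / 2 * (1 - n)) := by
  have hsub : rectWindow a' b' ⊆ rectWindow a b := fun x hx => by
    have h := mem_rectWindow'.1 hx
    exact mem_rectWindow'.2 ⟨⟨h.1.1, by omega⟩, ⟨h.2.1, by omega⟩⟩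
  exact ltiRectNode_of_andersonCluster_subset t U n ha hb (rectWindow a' b') hsub (rectBondWeights w)
    (rectSiteWeights v) (by rw [bondWeightSum_rect_zero']; exact hw0) (by rw [bondWeightSum_rect_one']; exact hw1)
    (by rw [siteWeightSum_rect']; exact hv) hq

omit hρ in
/-- **DOMINANCE EDGE for `rot`-type rows (total bond weight 2) when the window holds the cluster AND its transpose**
(e.g. a square window `a × a`, `a ≥ max a' b'`, and an `a' × b'` cluster): averaging the two positivity inequalities
equalises the directions, exactly as in the thermodynamic-limit soundness proof of the `rot` rows. -/
theorem ltiRectNode_of_andersonCluster_transposePair_subset (t U n : ℝ) {a b : ℕ} (ha : 2 ≤ a) (hb : 2 ≤ b)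
    (R : Finset (Site 2)) (hR : R ⊆ rectWindow a b) (hRT : transposeWindow R ⊆ rectWindow a b)
    (w : Site 2 → Fin 2 → ℝ) (v : Site 2 → ℝ) {q : ℝ} (hw : bondWeightSum R w 0 + bondWeightSum R w 1 = 2)
    (hv : siteWeightSum R v = 1) (hq : (andersonCluster R t U w v - (q : ℂ) • (1 : FermionOp R)).PosSemidef) :
    LTIRectNode t U a b n (q - U / 2 * (1 - n)) := by
  intro ρ hpsd htr hlti hdens
  have hW := pair_subset_rectWindow ha hb
  have hval : ∀ {R' : Finset (Site 2)} (hR' : R' ⊆ rectWindow a b) (A : FermionOp R'),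
      (ρ * (fermionEmbed (PolySite.incl hR') A - (q : ℂ) • (1 : FermionOp (rectWindow a b)))).trace =
        wfun ρ hR' A - q := by
    intro R' hR' A
    rw [Matrix.mul_sub, Matrix.trace_sub, Matrix.mul_smul, Matrix.trace_smul, Matrix.mul_one, htr, smul_eq_mul, mul_one,
      wfun_apply]
  have h1 : ∀ {R' : Finset (Site 2)} (hR' : R' ⊆ rectWindow a b), wfun ρ hR' 1 = 1 := fun hR' => by
    rw [wfun_apply, map_one, Matrix.mul_one, htr]
  have hpos1 := Literature.LinearAlgebra.Matrix.re_trace_mul_nonneg_of_posSemidef hpsd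
    (posSemidef_fermionEmbed_sub_smul_one (PolySite.incl hR) hq)
  have hpos2 := Literature.LinearAlgebra.Matrix.re_trace_mul_nonneg_of_posSemidef hpsd
    (posSemidef_fermionEmbed_sub_smul_one (PolySite.incl hRT) (posSemidef_andersonCluster_transpose hq))
  rw [hval, hlti.wfun_andersonCluster t U hW hR, hv, h1, Fin.sum_univ_two] at hpos1
  rw [hval, hlti.wfun_andersonCluster t U hW hRT, siteWeightSum_transpose', hv, h1, Fin.sum_univ_two,
    bondWeightSum_transpose', bondWeightSum_transpose'] at hpos2
  have e1 : (0 : Fin 2).rev = 1 := rfl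
  have e2 : (1 : Fin 2).rev = 0 := rfl
  rw [e1, e2] at hpos2
  rw [trace_mul_eq_wfun, hAvg, hlti.wfun_clusterHamiltonian t U hW (subset_refl _), Fin.sum_univ_two,
    bondWeightSum_avgBond_zero ha (by omega), bondWeightSum_avgBond_one (by omega) hb,
    siteWeightSum_avgSite (by omega) (by omega), siteWeightSum_zero]
  rw [hlti.trace_mul_totalNumber hW] at hdens
  have hcard := card_rectWindow' a b
  have hab : (0 : ℝ) < (a : ℝ) * b := by positivity
  have hd : (wDens ρ hW).re = n := by
    simp only [Complex.mul_re, Complex.natCast_re, Complex.natCast_im, zero_mul, sub_zero, hcard] at hdens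
    exact mul_left_cancel₀ hab.ne' hdens
  simp only [Complex.add_re, Complex.sub_re, Complex.mul_re, Complex.ofReal_re, Complex.ofReal_im, Complex.one_re,
    zero_mul, sub_zero, one_mul, hd] at hpos1 hpos2 ⊢
  have hW1 : bondWeightSum R w 1 = 2 - bondWeightSum R w 0 := by linarith
  rw [hW1] at hpos1 hpos2
  linarith

omit hρ in
/-- Rectangles are monotone: `[0,a') × [0,b') ⊆ [0,a) × [0,b)` for `a' ≤ a`, `b' ≤ b`. -/
theorem rectWindow_subset_rectWindow {a b a' b' : ℕ} (ha' : a' ≤ a) (hb' : b' ≤ b) :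
    rectWindow a' b' ⊆ rectWindow a b := fun x hx => by
  have h := mem_rectWindow'.1 hx
  exact mem_rectWindow'.2 ⟨⟨h.1.1, by omega⟩, ⟨h.2.1, by omega⟩⟩

omit hρ in
/-- The transpose of `[0,a') × [0,b')` is `[0,b') × [0,a')`, inside `[0,a) × [0,b)` when `b' ≤ a`, `a' ≤ b`. -/
theorem transposeWindow_rectWindow_subset {a b a' b' : ℕ} (hb' : b' ≤ a) (ha' : a' ≤ b) :
    transposeWindow (rectWindow a' b') ⊆ rectWindow a b := fun z hz => by
  have h := mem_rectWindow'.1 (mem_transposeWindow'.1 hz)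
  have h0 : swapSite z 0 = z 1 := rfl
  have h1 : swapSite z 1 = z 0 := rfl
  rw [h0, h1] at h
  exact mem_rectWindow'.2 ⟨⟨h.2.1, by omega⟩, ⟨h.1.1, by omega⟩⟩

omit hρ in
open Summit.HubbardSuperconductivity.ManyBodyBootstrap.Bounds in
/-- **Instance: the LTI node of every square window `a × a`, `a ≥ 4`, dominates the programme's best certified 2-D
Anderson row at `U = 8`** (`anderson_psd_rect2x4rot_opt_U8`, the `4 × 2` cluster and its `2 × 4` transpose both fit):
`LTIRectNode 1 8 a a n (q - 4 (1 - n))` for every density `n`. -/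
theorem ltiRectNode_of_rect2x4rot_opt_U8 (n : ℝ) {a : ℕ} (ha : 4 ≤ a) (h : anderson_psd_rect2x4rot_opt_U8) :
    LTIRectNode 1 8 a a n
      ((((-214327093049334212810432623 / 281474976710656000000000000 : ℚ) : ℝ)) - 8 / 2 * (1 - n)) :=
  ltiRectNode_of_andersonCluster_transposePair_subset 1 8 n (by omega) (by omega) (rectWindow 4 2)
    (rectWindow_subset_rectWindow (by omega) (by omega)) (transposeWindow_rectWindow_subset (by omega) (by omega))
    (rectBondWeights w_rect2x4rot_opt_U8) (rectSiteWeights v_rect2x4rot_opt_U8)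
    (by rw [bondWeightSum_rect_zero', bondWeightSum_rect_one']; norm_num [Finset.sum_range_succ, w_rect2x4rot_opt_U8])
    (by rw [siteWeightSum_rect']; norm_num [Finset.sum_range_succ, v_rect2x4rot_opt_U8]) h

end Dominance

end Summit.Ventures.CertifiedManyBodySolver.Rows.RectMarginalNodes

end
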